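import Summits.CriticalPhenomena.PercolationContinuityZ3.Theorems.PercNearOneGluingNoHeavyQuantFarGate3Reach
import HarnessLib

/-!
# QUANT lane R8, front "FAR beyond trees", layer one — THE DEGREE-THREE GATE AT THE OBSERVER, VII: the outside relays (counting)

builds on p205010 (kernel theorem, internal audit signed; external expert review pending)

Support file (`--supports stmt-CriticalPhenomena-4575`), seat `prim-quant-p1` (gen 28); memo
`run/shared/lean/prim/quant/prim-quant-p1-g28/FOR-LEAD-GATE3.md` §1, §7.  Pure combinatorics (no measure); standard axioms; no sorries;
no definitions.

Setting of file I.  The relays other than `v, u₁, u₂` ("outside relays", a finset `B` avoiding `v`) are reached by the observer either off `v`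
(`K = #{b ∈ B : o ~ b off v}`) or through the gate: by `Gate3.reach_iff_of_ne`, on a good configuration
`o ↔ b ⟺ o ~ b off v ∨ (VR ∧ ((s(v,u₁) ∈ ω ∧ u₁ ~ b off v) ∨ (s(v,u₂) ∈ ω ∧ u₂ ~ b off v)))`.  This file provides the counting facts used
by the first-moment ("mean") bookkeeping of the general gate (memo §5: the `sub` column of the reduced LP):
* `Gate3.card_out_eq` — `#{b ∈ B : o ↔ b} = K + [VR]·#{b ∈ B : o ≁ b ∧ ((s(v,u₁) ∈ ω ∧ u₁ ~ b) ∨ (s(v,u₂) ∈ ω ∧ u₂ ~ b)) off v}`;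
* `Gate3.card_eq` — the observer's full relay count `#{a ∈ A : o ↔ a}` as `[o↔v] + [o↔u₁] + [o↔u₂] +` the above (`B = A ∖ {v,u₁,u₂}`);
* `Gate3.feed_add_reach_le` — `K + F ≤ |B|` for the feedback relays `F = #{b ∈ B : o ≁ b ∧ (u₁ ~ b ∨ u₂ ~ b) off v}`, and the type
  restrictions `Gate3.feed₁_eq_zero_of_G₁` (on `G₁ = [o ~ u₁ off v]` no feedback relay hangs on `u₁`), `feed₂_eq_zero_of_G₂`;
* `Gate3.count_le` — the pointwise first-moment bound `K + f·F ≤ f·n·[K = 0] + (1 + f(n−1))·[K = 1] + n·[K ≥ 2]` (`0 ≤ f ≤ 1`, `n = |B|`).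
[cite: Grimmett1999, §1.3 p. 10] (open paths / clusters); the bookkeeping is [this work].
-/

namespace Summit.CriticalPhenomena.PercolationContinuityZ3.Theorems

namespace Quant

namespace Gate3

open Finset
open Literature.Probability.Percolation
open Bundle (offZ offZ_subset reachable_of_offZ)
open scoped Classical

variable {n : ℕ} {o v u₁ u₂ : Fin n}

/-! ## The outside relays on a good configuration -/

section Good

variable {ω : BondConfig (Fin n)}
  (hω : ∀ z : Fin n, z ≠ o → z ≠ u₁ → z ≠ u₂ → z ≠ v → s(v, z) ∉ ω)
  (hov : o ≠ v) (h1v : u₁ ≠ v) (h2v : u₂ ≠ v)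
include hω hov h1v h2v

/-- **Outside relays.**  For a finset `B` avoiding `v`: the relays of `B` joined to `o` are those joined off `v`, plus — when the gate is
reached (`VR`) — the feedback relays hanging on an open arm of the gate. [this work] -/
theorem card_out_eq (B : Finset (Fin n)) (hB : v ∉ B) :
    (B.filter fun b => ω ∈ openConn o b).card =
      (B.filter fun b => offZ {v} ω ∈ openConn o b).card +
        (if s(o, v) ∈ ω ∨ (s(v, u₁) ∈ ω ∧ (openGraph (offZ {v} ω)).Reachable o u₁) ∨
            (s(v, u₂) ∈ ω ∧ (openGraph (offZ {v} ω)).Reachable o u₂) then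
          (B.filter fun b => ¬ (openGraph (offZ {v} ω)).Reachable o b ∧
            ((s(v, u₁) ∈ ω ∧ (openGraph (offZ {v} ω)).Reachable u₁ b) ∨
              (s(v, u₂) ∈ ω ∧ (openGraph (offZ {v} ω)).Reachable u₂ b))).card
        else 0) := by
  by_cases hV : s(o, v) ∈ ω ∨ (s(v, u₁) ∈ ω ∧ (openGraph (offZ {v} ω)).Reachable o u₁) ∨
      (s(v, u₂) ∈ ω ∧ (openGraph (offZ {v} ω)).Reachable o u₂)
  · rw [if_pos hV, ← card_union_of_disjoint]
    · congr 1
      ext b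
      simp only [mem_filter, mem_union]
      constructor
      · rintro ⟨hb, hr⟩
        have hbv : b ≠ v := fun h => hB (h ▸ hb)
        rcases (reach_iff_of_ne hω hov h1v h2v hbv).1 hr with h | ⟨-, h⟩
        · exact Or.inl ⟨hb, h⟩
        · by_cases hob : (openGraph (offZ {v} ω)).Reachable o b
          · exact Or.inl ⟨hb, hob⟩
          · exact Or.inr ⟨hb, hob, h⟩
      · rintro (⟨hb, h⟩ | ⟨hb, -, h⟩)
        · exact ⟨hb, reachable_of_offZ h⟩
        · have hbv : b ≠ v := fun h' => hB (h' ▸ hb)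
          exact ⟨hb, (reach_iff_of_ne hω hov h1v h2v hbv).2 (Or.inr ⟨hV, h⟩)⟩
    · rw [disjoint_filter]
      intro b _ h1 h2
      exact h2.1 h1
  · rw [if_neg hV, add_zero]
    congr 1
    refine filter_congr fun b hb => ?_
    have hbv : b ≠ v := fun h => hB (h ▸ hb)
    show (openGraph ω).Reachable o b ↔ (openGraph (offZ {v} ω)).Reachable o b
    rw [reach_iff_of_ne hω hov h1v h2v hbv]
    constructor
    · rintro (h | ⟨h, -⟩)
      · exact h
      · exact absurd h hV
    · exact fun h => Or.inl h

/-- **The observer's relay count on a good configuration** (`v, u₁, u₂ ∈ A` distinct): the three gate relays plus the outside relays.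
[this work] -/
theorem card_eq {A : Finset (Fin n)} (hvA : v ∈ A) (h1A : u₁ ∈ A) (h2A : u₂ ∈ A) (h12 : u₁ ≠ u₂) :
    (A.filter fun a => ω ∈ openConn o a).card =
      (if ω ∈ openConn o v then 1 else 0) + (if ω ∈ openConn o u₁ then 1 else 0) + (if ω ∈ openConn o u₂ then 1 else 0) +
      (((((A.erase v).erase u₁).erase u₂).filter fun b => offZ {v} ω ∈ openConn o b).card +
        (if s(o, v) ∈ ω ∨ (s(v, u₁) ∈ ω ∧ (openGraph (offZ {v} ω)).Reachable o u₁) ∨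
            (s(v, u₂) ∈ ω ∧ (openGraph (offZ {v} ω)).Reachable o u₂) then
          ((((A.erase v).erase u₁).erase u₂).filter fun b => ¬ (openGraph (offZ {v} ω)).Reachable o b ∧
            ((s(v, u₁) ∈ ω ∧ (openGraph (offZ {v} ω)).Reachable u₁ b) ∨
              (s(v, u₂) ∈ ω ∧ (openGraph (offZ {v} ω)).Reachable u₂ b))).card
        else 0)) := by
  have h1A' : u₁ ∈ A.erase v := mem_erase.2 ⟨h1v, h1A⟩
  have h2A' : u₂ ∈ (A.erase v).erase u₁ := mem_erase.2 ⟨h12.symm, mem_erase.2 ⟨h2v, h2A⟩⟩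
  have hB : v ∉ ((A.erase v).erase u₁).erase u₂ := fun h =>
    (notMem_erase v A) (mem_of_mem_erase (mem_of_mem_erase h))
  rw [EarAtObserver.card_filter_eq_ite_add (o := o) hvA, EarAtObserver.card_filter_eq_ite_add (o := o) h1A',
    EarAtObserver.card_filter_eq_ite_add (o := o) h2A', card_out_eq hω hov h1v h2v _ hB]
  ring

end Good

/-! ## Counting facts for the first-moment bound (any configuration) -/

/-- The relays reached off `v` and the feedback relays are disjoint: `K + F ≤ |B|`. [this work] -/
theorem feed_add_reach_le (η : BondConfig (Fin n)) (B : Finset (Fin n)) :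
    (B.filter fun b => η ∈ openConn o b).card +
      (B.filter fun b => ¬ (openGraph η).Reachable o b ∧ ((openGraph η).Reachable u₁ b ∨ (openGraph η).Reachable u₂ b)).card ≤
        B.card := by
  rw [← card_union_of_disjoint]
  · exact card_le_card (union_subset (filter_subset _ _) (filter_subset _ _))
  · rw [disjoint_filter]
    intro b _ h1 h2
    exact h2.1 h1

/-- On `G₁ = [o ~ u₁]` no feedback relay hangs on `u₁`. [this work] -/
theorem feed₁_eq_zero_of_G₁ (η : BondConfig (Fin n)) (B : Finset (Fin n)) (hG : (openGraph η).Reachable o u₁) :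
    (B.filter fun b => ¬ (openGraph η).Reachable o b ∧ (openGraph η).Reachable u₁ b).card = 0 := by
  rw [card_eq_zero, filter_eq_empty_iff]
  rintro b - ⟨h1, h2⟩
  exact h1 (hG.trans h2)

/-- On `G₂ = [o ~ u₂]` no feedback relay hangs on `u₂`. [this work] -/
theorem feed₂_eq_zero_of_G₂ (η : BondConfig (Fin n)) (B : Finset (Fin n)) (hG : (openGraph η).Reachable o u₂) :
    (B.filter fun b => ¬ (openGraph η).Reachable o b ∧ (openGraph η).Reachable u₂ b).card = 0 := by
  rw [card_eq_zero, filter_eq_empty_iff]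
  rintro b - ⟨h1, h2⟩
  exact h1 (hG.trans h2)

/-- The gated feedback relays are feedback relays. [this work] -/
theorem gatedFeed_le_feed (η : BondConfig (Fin n)) (B : Finset (Fin n)) (P₁ P₂ : Prop) :
    (B.filter fun b => ¬ (openGraph η).Reachable o b ∧
        ((P₁ ∧ (openGraph η).Reachable u₁ b) ∨ (P₂ ∧ (openGraph η).Reachable u₂ b))).card ≤
      (B.filter fun b => ¬ (openGraph η).Reachable o b ∧ ((openGraph η).Reachable u₁ b ∨ (openGraph η).Reachable u₂ b)).card := by
  refine card_le_card fun b hb => ?_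
  simp only [mem_filter] at hb ⊢
  rcases hb with ⟨hb, h0, (⟨-, h⟩ | ⟨-, h⟩)⟩
  · exact ⟨hb, h0, Or.inl h⟩
  · exact ⟨hb, h0, Or.inr h⟩

/-- **Pointwise first-moment bound.**  With `K = #{b ∈ B : o ~ b}`, `F = #{b ∈ B : o ≁ b, u₁ ~ b ∨ u₂ ~ b}`, `n = |B|` and a feed rate
`0 ≤ f ≤ 1`: `K + f·F ≤ f·n·[K = 0] + (1 + f(n−1))·[K = 1] + n·[2 ≤ K]`. [this work] -/
theorem count_le (η : BondConfig (Fin n)) (B : Finset (Fin n)) {f : ℝ} (hf0 : 0 ≤ f) (hf1 : f ≤ 1) :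
    ((B.filter fun b => η ∈ openConn o b).card : ℝ) +
        f * (B.filter fun b => ¬ (openGraph η).Reachable o b ∧ ((openGraph η).Reachable u₁ b ∨ (openGraph η).Reachable u₂ b)).card ≤
      f * B.card * (if (B.filter fun b => η ∈ openConn o b).card = 0 then (1 : ℝ) else 0) +
      (1 + f * (B.card - 1)) * (if (B.filter fun b => η ∈ openConn o b).card = 1 then (1 : ℝ) else 0) +
      B.card * (if 2 ≤ (B.filter fun b => η ∈ openConn o b).card then (1 : ℝ) else 0) := by
  set K := (B.filter fun b => η ∈ openConn o b).card with hK
  set F := (B.filter fun b => ¬ (openGraph η).Reachable o b ∧ ((openGraph η).Reachable u₁ b ∨ (openGraph η).Reachable u₂ b)).card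
    with hF
  have hKF : K + F ≤ B.card := feed_add_reach_le (o := o) (u₁ := u₁) (u₂ := u₂) η B
  have hKF' : (K : ℝ) + F ≤ B.card := by exact_mod_cast hKF
  have hF0 : (0 : ℝ) ≤ F := Nat.cast_nonneg _
  have hK0 : (0 : ℝ) ≤ K := Nat.cast_nonneg _
  have hfF : f * (F : ℝ) ≤ F := by nlinarith
  by_cases h0 : K = 0
  · have e : (K : ℝ) = 0 := by exact_mod_cast h0
    have n1 : ¬ K = 1 := by omega
    have n2 : ¬ 2 ≤ K := by omega
    rw [if_pos h0, if_neg n1, if_neg n2, e]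
    have : (F : ℝ) ≤ B.card := by linarith
    nlinarith
  · rw [if_neg h0]
    by_cases h1 : K = 1
    · have e : (K : ℝ) = 1 := by exact_mod_cast h1
      have n2 : ¬ 2 ≤ K := by omega
      rw [if_pos h1, if_neg n2, e]
      have : (F : ℝ) ≤ B.card - 1 := by linarith
      nlinarith
    · have h2 : 2 ≤ K := by omega
      rw [if_neg h1, if_pos h2]
      nlinarith

end Gate3

end Quant

end Summit.CriticalPhenomena.PercolationContinuityZ3.Theorems
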